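import Mathlib
import Summits.NavierStokesRegularity.NavierStokesRegularity.Theorems.TaoLadderRungTwoFlatInterfaceTransient
import Summits.NavierStokesRegularity.NavierStokesRegularity.Theorems.TaoLadderRungTwoFlatNearBehindAprioriIface
import HarnessLib

/-!
# THE INTERFACE LOOP OF RECORD (theory-1 g48 numT61, P-61a analytic core): the two interface deviations at shell `1−K`
  are bootstrap quantities closed by the near level, the section datum and the carrier deviation one shell deeper
  (helper for the K_A♭ parent item stmt-NavierStokesRegularity-22987 `FlatGapCertificatesV2`, child 2A `GradedAdiabaticWakeA`
  of route TaoLadderRungTwoFlat; cell harvest/h2-tao-ladder, p1 g24; LADDER §61)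

`interface_apriori_of_pseudoFlows`: along a hop flow `S` and a reference flow `W` (exact graded mirror flows on `[0, τ]`), on a
window `[0, t]` (`0 < t ≤ τ`, `t ≤ c₀`), the interface deviations `u₀(1−K)`, `u₁(1−K)` (`u = S − W`) stay below the levels
`RBAR`, `BBAR` provided

* the section datum `|uᵢ(1−K, 0)| ≤ r_s`, the carrier deviation one shell deeper `|u₀(2−K, s)| ≤ ρ₂` on `[0, t]` (the ONLY
  exogenous core input, theory-1 L-61d), templates `M` (block `[−D, 1−K]`), `M₁` (bond at `−K`), `M₂` (carrier at `2−K`);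
* the two INTERFACE LEVELS (L-61a) `r_s + PUMP + c₀·((ε(M + I₁√(2V̄_N)) + εM + ε·BBAR)·RBAR + (2+ε)M·BBAR + BBAR²) < RBAR`,
  `PUMP = c₀·((2+ε)M·I₁√(2V̄_N) + 2I₂V̄_N)`, and (L-61b) `r_s + c₀·((M + M₂ + RBAR + ρ₂)BBAR + (1+2ε)M·RBAR + ε·RBAR² +
  (M + 2εM₂)ρ₂ + ερ₂²) < BBAR`, with the link facts `2(e^{θ_V/2} − 1) ≤ I₁θ_V`, `e^{θ_V} − 1 ≤ I₂θ_V` (`θ_V > 0`);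
* the near/behind schedule hypotheses of `R54.near_behind_apriori_of_pseudoFlows_iface` in their window (`1/c₀`, `·c₀`) forms
  with the interface level `r ≥ RBAR, BBAR` in place of the old core input.

PROOF: `Bootstrap.Icc_induction₂` on `(|u₀(1−K,·)|, |u₁(1−K,·)|)`; at the induction time `T` the a-priori levels on `[0, T]` feed
`near_behind_apriori_of_pseudoFlows_iface` on `[0, T]` (co-moving speed `1/T`), whose near-energy conclusion gives the pump source
`|u₁(−K, x)| ≤ √(2V̄_N)·e^{θ_V x/(2T)}`; then `MirrorPulse.interface_carrier_le` / `interface_bond_le` integrate the two interface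
equations up to `T ≤ c₀`. No propagator bound, no Grönwall factor, no gauge sup-norm anywhere (referee W-27 as re-keyed).

HONEST FRAMING: inequalities about MODEL-lattice certificate flows (graded mirror table on `S♭`, `m = 2`); the schedule
inequalities, templates and the deeper core input `ρ₂` are HYPOTHESES; nothing certified; no item closed; nothing about the
Navier–Stokes equations.
-/

noncomputable section

-- the sub-problem namespace repeats the summit name by design (D-0017)
set_option linter.dupNamespace false

namespace Summit.NavierStokesRegularity.NavierStokesRegularity.Theorems.HopTube.R54

open Set Finset Literature.Analysis.FluidPDE Literature.Analysis.FluidPDE.TaoCascade MirrorPulse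

section Loop

variable {ε ε₀ τ κ₂ κ₂' : ℝ} {W₀ FW₀ BW₀ S₀ FS₀ BS₀ : Fin 2 → ℤ → ℝ} {W FW S FS : Fin 2 → ℤ → ℝ → ℝ}

set_option maxHeartbeats 400000 in
/-- **THE INTERFACE LOOP** (theory-1 numT61 L-61a/L-61b, P-61a analytic core). See the module docstring.
[cite: Tao2016AveragedNS, §4 (4.1), (4.3), (4.8), §5 (continuity argument, statement shape); route TaoLadderRungTwoFlat, interface loop of record (cell LADDER §61, referee W-27)] -/
theorem interface_apriori_of_pseudoFlows
    (hW : PseudoFlowOnShift shiftSetFlat τ ε₀ (mirrorTable ε ε) 0 κ₂ W₀ FW₀ BW₀ W FW)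
    (hS : PseudoFlowOnShift shiftSetFlat τ ε₀ (mirrorTable ε ε) 0 κ₂' S₀ FS₀ BS₀ S FS)
    (hε : 0 ≤ ε) (hε₀ : 0 < ε₀) {K D : ℕ} (hK : 1 ≤ K) (hDK : K + 1 ≤ D)
    {θV θ' t c₀ Aeff A A₀ A₁ M M₁ M₂ r RBAR BBAR RHO2 rs I₁ I₂ PUMP μN μB V₀N V₀B VbarN VbarB : ℝ}
    (hθV : 0 < θV) (hθ : 0 ≤ θ') (hθ5 : θ' ≤ 5 * Real.log (1 + ε₀)) (hAeff : 0 < Aeff)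
    (ht : 0 < t) (htτ : t ≤ τ) (htc : t ≤ c₀)
    (hM0 : 0 ≤ M) (hM : ∀ s ∈ Icc 0 t, ∀ i, ∀ m ∈ Finset.Icc (-(D : ℤ)) (1 - (K : ℤ)), |W i m s| ≤ M)
    (hM₁ : ∀ s ∈ Icc 0 t, |W 1 (-(K : ℤ)) s| ≤ M₁)
    (hM₂0 : 0 ≤ M₂) (hM₂ : ∀ s ∈ Icc 0 t, |W 0 (2 - (K : ℤ)) s| ≤ M₂)
    -- section datum and the deeper core input
    (hsec : ∀ i, |(S - W) i (1 - (K : ℤ)) 0| ≤ rs)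
    (hρ0 : 0 ≤ RHO2) (hρ : ∀ s ∈ Icc 0 t, |(S - W) 0 (2 - (K : ℤ)) s| ≤ RHO2)
    -- interface levels
    (hRB0 : 0 ≤ RBAR) (hBB0 : 0 ≤ BBAR) (hRr : RBAR ≤ r) (hBr : BBAR ≤ r) (hVN0 : 0 ≤ VbarN)
    (hI₁0 : 0 ≤ I₁) (hI₂0 : 0 ≤ I₂)
    (hI₁ : 2 * (Real.exp (θV / 2) - 1) ≤ I₁ * θV) (hI₂ : Real.exp θV - 1 ≤ I₂ * θV)
    (hPUMPdef : PUMP = 1 * c₀ * ((2 + ε) * M * I₁ * Real.sqrt (2 * VbarN) + 2 * I₂ * VbarN))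
    (hlevC : rs + PUMP + 1 * c₀ * ((ε * (M + I₁ * Real.sqrt (2 * VbarN)) + ε * M + ε * BBAR) * RBAR
      + (2 + ε) * M * BBAR + BBAR ^ 2) < RBAR)
    (hlevV : rs + 1 * c₀ * ((M + M₂ + RBAR + RHO2) * BBAR + (1 + 2 * ε) * M * RBAR + ε * RBAR ^ 2
      + (M + 2 * ε * M₂) * RHO2 + ε * RHO2 ^ 2) < BBAR)
    -- near/behind schedule (window forms), interface level `r` as the old core input
    (hAdef : A = Real.sqrt (2 * VbarB) * Real.exp (θ' / 2) * Real.exp (θ' * ((D : ℝ) - K) / 2) + M)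
    (hA₀def : A₀ = M + r) (hA₁def : A₁ = M₁ + Real.sqrt (2 * VbarN) * Real.exp (θV / 2))
    (hrA : r ≤ A) (hA₀le : A₀ ≤ Aeff)
    (hV₀N : coMovingEnergyOn (Finset.Icc (1 - (D : ℤ)) (-(K : ℤ))) θV (-(K : ℝ)) (S - W) 0 ≤ V₀N)
    (hV₀B : ∀ L : ℕ, coMovingEnergyOn (Finset.Icc (1 - (K : ℤ) - L) (-(K : ℤ))) θ' (-(K : ℝ)) S 0 ≤ V₀B)
    (hμN : 0 < μN)
    (hμNle : μN ≤ (1 / c₀) * θV - 2 * (1 + ε) * 1 * (A * Real.sinh (θV / 2) + M * (3 + Real.exp θV)))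
    (hμB : 0 < μB) (hμBle : μB ≤ (1 / c₀) * θ' - 2 * (1 + ε) * Aeff * Real.sinh (θ' / 2))
    (hlevN : V₀N + (Real.exp (θV * ((1 : ℝ) - D + K)) * ((1 + ε) * 1 * A ^ 2 * (A + M))
        + 1 * r * (2 * VbarN + ε * r * Real.sqrt (2 * VbarN) + (1 + ε) * M * r)) * c₀ < VbarN)
    (hlevB : V₀B + A₁ * A₀ * (A₁ + ε * A₀) * c₀ < VbarB)
    (hclose : Real.sqrt (2 * VbarB) * Real.exp (θ' / 2) ≤ Aeff) :
    ∀ s ∈ Icc 0 t, |(S - W) 0 (1 - (K : ℤ)) s| ≤ RBAR ∧ |(S - W) 1 (1 - (K : ℤ)) s| ≤ BBAR := by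
  have hr0 : 0 ≤ r := hRB0.trans hRr
  have hc₀ : 0 < c₀ := ht.trans_le htc
  have hsV0 : 0 ≤ Real.sqrt (2 * VbarN) := Real.sqrt_nonneg _
  have hA0 : 0 ≤ A := hr0.trans hrA
  -- the near edge input is nonnegative
  set EN : ℝ := Real.exp (θV * ((1 : ℝ) - D + K)) * ((1 + ε) * 1 * A ^ 2 * (A + M))
      + 1 * r * (2 * VbarN + ε * r * Real.sqrt (2 * VbarN) + (1 + ε) * M * r) with hENdef
  have hEN0 : 0 ≤ EN := by positivity
  have hA₁0 : 0 ≤ A₁ := by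
    rw [hA₁def]
    have hM₁0 : 0 ≤ M₁ := (abs_nonneg _).trans (hM₁ 0 ⟨le_rfl, ht.le⟩)
    positivity
  have hA₀0 : 0 ≤ A₀ := by rw [hA₀def]; positivity
  have hEtop0 : 0 ≤ A₁ * A₀ * (A₁ + ε * A₀) := by positivity
  -- the two levels dominate the section datum
  set XC : ℝ := (ε * (M + I₁ * Real.sqrt (2 * VbarN)) + ε * M + ε * BBAR) * RBAR + (2 + ε) * M * BBAR + BBAR ^ 2
    with hXC
  set XV : ℝ := (M + M₂ + RBAR + RHO2) * BBAR + (1 + 2 * ε) * M * RBAR + ε * RBAR ^ 2 + (M + 2 * ε * M₂) * RHO2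
    + ε * RHO2 ^ 2 with hXV
  have hXC0 : 0 ≤ XC := by positivity
  have hXV0 : 0 ≤ XV := by positivity
  have hPUMP0 : 0 ≤ PUMP := by rw [hPUMPdef]; positivity
  set LC : ℝ := rs + PUMP + 1 * c₀ * XC with hLC
  set LV : ℝ := rs + 1 * c₀ * XV with hLV
  have hrsLC : rs ≤ LC := by
    rw [hLC]; have : 0 ≤ 1 * c₀ * XC := by positivity
    linarith
  have hrsLV : rs ≤ LV := by
    rw [hLV]; have : 0 ≤ 1 * c₀ * XV := by positivity
    linarith
  -- continuity of the two interface deviations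
  have hsub : Icc 0 t ⊆ Icc 0 τ := Icc_subset_Icc le_rfl htτ
  have hcont : ∀ i, ContinuousOn (fun s => |(S - W) i (1 - (K : ℤ)) s|) (Icc 0 t) := by
    intro i
    have hS' := (QuadPolar.continuousOn_of_pseudoFlowOnShift hS i (1 - (K : ℤ))).mono hsub
    have hW' := (QuadPolar.continuousOn_of_pseudoFlowOnShift hW i (1 - (K : ℤ))).mono hsub
    have e : (fun s => |(S - W) i (1 - (K : ℤ)) s|) = fun s => |S i (1 - (K : ℤ)) s - W i (1 - (K : ℤ)) s| := by
      funext s; simp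
    rw [e]; exact (hS'.sub hW').abs
  -- continuous induction on the pair
  have key := Bootstrap.Icc_induction₂ (f := fun s => |(S - W) 0 (1 - (K : ℤ)) s|)
    (g := fun s => |(S - W) 1 (1 - (K : ℤ)) s|) (T := t) (a₁ := RBAR) (b₁ := LC) (a₂ := BBAR) (b₂ := LV)
    ht.le (hcont 0) (hcont 1) hlevC hlevV ((hsec 0).trans hrsLC) ((hsec 1).trans hrsLV) ?_
  · intro s hs
    obtain ⟨h0, h1⟩ := key s hs
    exact ⟨h0.trans hlevC.le, h1.trans hlevV.le⟩
  -- THE STEP: a-priori levels on `[0, T]` ⇒ the two levels at `T`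
  intro T hT hpast
  rcases eq_or_lt_of_le hT.1 with h0T | hTpos
  · rw [← h0T]; exact ⟨(hsec 0).trans hrsLC, (hsec 1).trans hrsLV⟩
  have hTt : T ≤ t := hT.2
  have hTτ : T ≤ τ := hTt.trans htτ
  have hTc : T ≤ c₀ := hTt.trans htc
  -- the interface level `r` on `[0, T]`
  have hrT : ∀ s ∈ Icc 0 T, ∀ i, |(S - W) i (1 - (K : ℤ)) s| ≤ r := by
    intro s hs i
    obtain ⟨h0, h1⟩ := hpast s hs
    fin_cases i
    · exact h0.trans hRr
    · exact h1.trans hBr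
  -- window forms at `T`
  have h1T : 1 / c₀ ≤ 1 / T := one_div_le_one_div_of_le hTpos hTc
  have hστ : (1 / T) * T = 1 := by rw [one_div, inv_mul_cancel₀ (ne_of_gt hTpos)]
  have hμNle' : μN ≤ (1 / T) * θV - 2 * (1 + ε) * 1 * (A * Real.sinh (θV / 2) + M * (3 + Real.exp θV)) := by
    have h2 := mul_le_mul_of_nonneg_right h1T hθV.le
    linarith only [h2, hμNle]
  have hμBle' : μB ≤ (1 / T) * θ' - 2 * (1 + ε) * Aeff * Real.sinh (θ' / 2) := by
    have h2 := mul_le_mul_of_nonneg_right h1T hθ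
    linarith only [h2, hμBle]
  have hlevN' : V₀N + EN * T < VbarN := by
    have h2 := mul_le_mul_of_nonneg_left hTc hEN0
    linarith only [h2, hlevN]
  have hlevB' : V₀B + A₁ * A₀ * (A₁ + ε * A₀) * T < VbarB := by
    have h2 := mul_le_mul_of_nonneg_left hTc hEtop0
    linarith only [h2, hlevB]
  have hMT : ∀ s ∈ Icc 0 T, ∀ i, ∀ m ∈ Finset.Icc (-(D : ℤ)) (1 - (K : ℤ)), |W i m s| ≤ M :=
    fun s hs => hM s ⟨hs.1, hs.2.trans hTt⟩
  have hM₁T : ∀ s ∈ Icc 0 T, |W 1 (-(K : ℤ)) s| ≤ M₁ := fun s hs => hM₁ s ⟨hs.1, hs.2.trans hTt⟩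
  -- the near/behind a-priori loop on `[0, T]` (co-moving speed `1/T`): the near LEVEL on `[0, T]`
  rw [hENdef] at hlevN'
  obtain ⟨-, -, hnear, -⟩ := near_behind_apriori_of_pseudoFlows_iface hW hS hε hε₀ hDK hθV.le hθ hθ5 hAeff hTpos hTτ
    hστ hM0 hMT hM₁T hrT hr0 hVN0 hAdef hA₀def hA₁def hrA hA₀le hV₀N hV₀B hμN hμNle' hμB hμBle' hlevN' hlevB'
    hclose
  -- the pump source: the near-top bond deviation read from the level
  have hmemK : (-(K : ℤ)) ∈ Finset.Icc (1 - (D : ℤ)) (-(K : ℤ)) := by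
    have : ((K + 1 : ℕ) : ℤ) ≤ (D : ℤ) := by exact_mod_cast hDK
    push_cast at this
    exact Finset.mem_Icc.mpr ⟨by omega, le_rfl⟩
  have hν : ∀ x ∈ Icc 0 T, |(S - W) 1 (1 - (K : ℤ) - 1) x| ≤ Real.sqrt (2 * VbarN) * Real.exp (θV * x / (2 * T)) := by
    intro x hx
    have h := abs_le_of_blockEnergy_le (hnear x hx) 1 hmemK
    have e1 : (1 - (K : ℤ) - 1) = -(K : ℤ) := by ring
    have e2 : θV * ((-(K : ℝ) + 1 / T * x) - (((-(K : ℤ)) : ℤ) : ℝ)) / 2 = θV * x / (2 * T) := by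
      push_cast; field_simp; ring
    rw [e1, ← e2]; exact h
  -- templates at the three interface sites and one shell deeper
  have hn : (1 - (K : ℤ)) ≤ 0 := by omega
  have hMC : ∀ x ∈ Icc 0 T, |W 1 (1 - (K : ℤ) - 1) x| ≤ M ∧ |W 0 (1 - (K : ℤ)) x| ≤ M ∧ |W 1 (1 - (K : ℤ)) x| ≤ M := by
    intro x hx
    refine ⟨hMT x hx 1 _ ?_, hMT x hx 0 _ ?_, hMT x hx 1 _ ?_⟩ <;> simp only [Finset.mem_Icc] <;> omega
  have hMV : ∀ x ∈ Icc 0 T, |W 0 (1 - (K : ℤ)) x| ≤ M ∧ |W 1 (1 - (K : ℤ)) x| ≤ M ∧ |W 0 (1 - (K : ℤ) + 1) x| ≤ M₂ := by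
    intro x hx
    have e3 : (1 - (K : ℤ) + 1) = 2 - (K : ℤ) := by ring
    refine ⟨hMT x hx 0 _ ?_, hMT x hx 1 _ ?_, ?_⟩
    · simp only [Finset.mem_Icc]; omega
    · simp only [Finset.mem_Icc]; omega
    · rw [e3]; exact hM₂ x ⟨hx.1, hx.2.trans hTt⟩
  have hRT : ∀ x ∈ Icc 0 T, |(S - W) 0 (1 - (K : ℤ)) x| ≤ RBAR := fun x hx => (hpast x hx).1
  have hBT : ∀ x ∈ Icc 0 T, |(S - W) 1 (1 - (K : ℤ)) x| ≤ BBAR := fun x hx => (hpast x hx).2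
  have hρT : ∀ x ∈ Icc 0 T, |(S - W) 0 (1 - (K : ℤ) + 1) x| ≤ RHO2 := by
    intro x hx
    have e3 : (1 - (K : ℤ) + 1) = 2 - (K : ℤ) := by ring
    rw [e3]; exact hρ x ⟨hx.1, hx.2.trans hTt⟩
  -- integrate the two interface equations up to `T ≤ c₀`
  have hC := interface_carrier_le hW hS hε hε₀.le hn hTpos hTτ hθV hM0 hRB0 hVN0 hMC hν hRT hBT hI₁ hI₂
  have hV := interface_bond_le hW hS hε hε₀.le hn hTpos hTτ hMV hRT hBT hρT
  refine ⟨hC.trans ?_, hV.trans ?_⟩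
  · -- carrier: `|u₀(0)| + T·(…) ≤ r_s + PUMP + c₀·XC`
    have hY0 : 0 ≤ (2 * M + ε * M) * I₁ * Real.sqrt (2 * VbarN) + 2 * I₂ * VbarN
        + ε * I₁ * Real.sqrt (2 * VbarN) * RBAR + ε * M * RBAR
        + ((2 + ε) * M * BBAR + BBAR ^ 2 + ε * M * RBAR + ε * RBAR * BBAR) := by positivity
    have hTY := mul_le_mul_of_nonneg_right hTc hY0
    have e : c₀ * ((2 * M + ε * M) * I₁ * Real.sqrt (2 * VbarN) + 2 * I₂ * VbarN
        + ε * I₁ * Real.sqrt (2 * VbarN) * RBAR + ε * M * RBAR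
        + ((2 + ε) * M * BBAR + BBAR ^ 2 + ε * M * RBAR + ε * RBAR * BBAR)) = PUMP + 1 * c₀ * XC := by
      rw [hPUMPdef, hXC]; ring
    rw [hLC]
    linarith [hsec 0, hTY, e]
  · -- bond: `|u₁(0)| + T·XV ≤ r_s + c₀·XV`
    have hTY := mul_le_mul_of_nonneg_right hTc hXV0
    rw [hLV]
    linarith [hsec 1, hTY]

end Loop

end Summit.NavierStokesRegularity.NavierStokesRegularity.Theorems.HopTube.R54

end
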